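import Literature.MathematicalPhysics.QuantumFieldTheory.Balaban1983to89.T4ContinuumYM4Torus

/-!
# Gaps / BetaGenericHeadline — skeleton SK-0 of `HOME/g1/ROUTES-PLAN-2.md` (cell pub-balaban-gaps, G1, lens structural):
# the β-binder of the T⁴ headline is a CURRENCY — the kernel implication holds for ANY β-side antecedent `Hβ` under which the
# spine slot is supplied; and non-vacuity needs endpoint existence at the datum's OWN torus exponent only

HONEST FRAMING (cell rule, page 1 of everything): the target is ONE kernel implication on ONE finite four-torus of fixed physical size —
`T4ContinuumYM4Torus.continuumYM4_torus_of_BetaPertH` (T4ContinuumYM4Torus.lean :538) ∕ its print-faithful twin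
`continuumYM4_torus_of_endpointExistence` (:814) — whose binders are OPEN.  Nothing of Bałaban's is asserted beyond print; [Balaban1987RG1]
Thm 2 is UNPROVED IN PRINT; 0∕13 main theorems and 0∕9 spine estimates are proved; this is NOT the continuum limit on ℝ⁴, NOT infinite
volume, NOT a mass gap, NOT Clay.  THIS MODULE DISCHARGES NOTHING: every theorem is a few lines of logic over theorems already in the tree
(`continuumYM4Torus_of_underHypotheses` :435, generic in `{Hβ : Prop}`; `T4ApexHybrid.underHypotheses_exists_iff_stringwiseUnder` :199 and
`stringwiseUnder_of_hybridNE7Under` :177, generic in `Hβ`; `T4Continuum.limitPointsAgree_of_exists` :996; `rp_and_covariant_of_printed` :570).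

WHAT IT MAKES KERNEL-EXPLICIT (ROUTES-PLAN-2 §0–§1, use-site reading U3, split S6).  In `continuumYM4_torus_of_endpointExistence` the β-binder
`hEnd : DagBinding.EndpointExistence D.C.toB12` is consumed in exactly two ways: (i) as the modus-ponens TOKEN firing the spine slot
`hNE : HybridNE7Under D Hβ`, whose conclusion is stated UNDER the antecedent `Hβ`; (ii) for NON-VACUITY of the `∀ tuned g₀` conclusion
(`T4Continuum.FiniteEpsData.exists_tuned` :1204).  Hence:
  * §1 `continuumYM4Torus_of_hybridNE7Under_any`: for printed-averaged data on `SU(N)`, (B) + ANY inhabited `Hβ` + the spine slot under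
    `Hβ` ⇒ `ContinuumYM4Torus D`.  Corollaries: `Hβ := True` (`…_true`: if the nine estimates were supplied for EVERY bare-coupling run, no
    β-statement at all is consumed — the ∀-form may then hold vacuously, `continuumYM4Torus_of_no_tuned` :485); `Hβ := EndpointExistence`
    recovers :814 (`example`); `Hβ := BetaPertHyp` recovers :547.
  * §2 `EndpointExistenceAt C m` — the ONE-EXPONENT instance of `DagBinding.EndpointExistence C` (:485, which quantifies ALL torus exponents
    `m`); `endpointExistence_iff_forall_at` (definitional); `exists_tuned_at`: tuned bare-coupling sequences of the datum exist already under
    `EndpointExistenceAt D.C.toB12 F.m` (the datum's `Tuned` fixes `m = F.m`, T4Continuum.lean :866); hence the non-vacuous headline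
    `continuumYM4Torus_of_endpointExistenceAt_nonvacuous` (alias `continuumYM4Torus_nonvacuous_of_at`, the skeleton's name; skeleton
    `HOME/g1/skeletons/SK0_BetaGenericHeadline.lean` b0db4a5639dcbb73 — both its stubs proved here) from the one-exponent binder — split S5, cosmetic for
    the β-function (which does not see `m` at END grade) but the exact non-vacuity content.
WHY THIS MATTERS FOR THE CELL'S TABLE (BALABAN-GAPS.md rows B3∕CAP+tail): the WEAKER the antecedent `Hβ`, the STRONGER the ask of the spine
(`HybridNE7Under` is anti-monotone in `Hβ`, `T4ApexHybrid.HybridNE7Under.of_imp`); the β-wall ((D1) ∧ (D4) ∧ CAP+tail) enters rung L1.2 only as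
the currency in which the nine estimates get `g_k ∈ ]0,γ]`, `g_K = g`, plus non-vacuity — CAP+tail (pointwise floor of β) is NOT on this path
(sibling module `Gaps/WeakestBetaCurrency`, skeleton SK-W).  All [folklore]; 0 sorry; 0 new hypotheses about Bałaban's objects.
-/

namespace Summit.QuantumFields.BalabanUV.Gaps.BetaGenericHeadline

open Literature.MathematicalPhysics.QuantumFieldTheory.Balaban1983to89
open Literature.MathematicalPhysics.QuantumFieldTheory.Balaban1983to89.T4Continuum
open Literature.MathematicalPhysics.QuantumFieldTheory.Balaban1983to89.T4Continuum.FiniteEpsData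
open Literature.MathematicalPhysics.QuantumFieldTheory.Balaban1983to89.T4ContinuumYM4Torus

universe u

/-! ## §1 The β-generic headline (split S6 ∕ use site U3(a)) -/

section Generic

variable {F : T4Family} {N : ℕ} [NeZero N]

/-- **SK-0 — THE β-GENERIC HEADLINE.**  For a printed-averaged finite-ε datum `D` on `SU(N)`: (B) (`B16.EndStatementBPrinted D.C`), ANY
inhabited β-side antecedent `Hβ`, and node U5's per-string hybrid-NE7 output UNDER `Hβ` (`T4ApexHybrid.HybridNE7Under D Hβ`) give
`ContinuumYM4Torus D`.  Proof = the tree's generic bookkeeping: existence under the prefix from the spine slot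
(`underHypotheses_exists_iff_stringwiseUnder … Hβ` ∘ `stringwiseUnder_of_hybridNE7Under`), uniqueness from existence
(`limitPointsAgree_of_exists`), reflection positivity and torus covariance OUTRIGHT for printed data (`rp_and_covariant_of_printed`), then
`continuumYM4Torus_of_underHypotheses`.  Every binder is a hypothesis; nothing of Bałaban's is asserted. [cite: JaffeWittenClay2006, §6.5 p.11] -/
theorem continuumYM4Torus_of_hybridNE7Under_any {Hβ : Prop} (D : FiniteEpsData F (Matrix.specialUnitaryGroup (Fin N) ℂ))
    (hD : D.IsPrintedAveraged) (hB : B16.EndStatementBPrinted D.C) (hβ : Hβ) (hNE : T4ApexHybrid.HybridNE7Under D Hβ) :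
    ContinuumYM4Torus D := by
  have hex : D.UnderHypotheses Hβ (fun g₀ => ∃ E : List (ULoop F) → ℝ, Missing.IsLimitFunctional (D.scheme g₀).expectAt E) :=
    (T4ApexHybrid.underHypotheses_exists_iff_stringwiseUnder D hD.avgMeasurable Hβ).mpr
      (T4ApexHybrid.stringwiseUnder_of_hybridNE7Under D hD.avgMeasurable hNE)
  have huniq : D.UnderHypotheses Hβ (fun g₀ => LimitPointsAgree (D.scheme g₀)) :=
    UnderHypotheses.mono (fun g₀ hE => limitPointsAgree_of_exists (D.scheme g₀) hE) hex
  have hrc := rp_and_covariant_of_printed D hD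
  exact continuumYM4Torus_of_underHypotheses hB hβ hex huniq
    (fun _ _ => ForSmallCouplings.of_forall fun g₀ => (hrc g₀).1)
    (fun _ _ => ForSmallCouplings.of_forall fun g₀ => (hrc g₀).2)

/-- Corollary `Hβ := True` — **β IS PURE CURRENCY**: if the spine slot were supplied under NO β-side antecedent (i.e. node U5's output for
every tuned run with nothing assumed about the coupling flow beyond (B)), then (B) alone gives `ContinuumYM4Torus D`; no (D1), (D4), CAP or
tail is consumed.  CAVEAT: without endpoint existence the ∀-over-tuned-sequences conclusion may be VACUOUS (`continuumYM4Torus_of_no_tuned`);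
see §2 for the exact non-vacuity binder. [folklore] -/
theorem continuumYM4Torus_of_hybridNE7Under_true (D : FiniteEpsData F (Matrix.specialUnitaryGroup (Fin N) ℂ))
    (hD : D.IsPrintedAveraged) (hB : B16.EndStatementBPrinted D.C) (hNE : T4ApexHybrid.HybridNE7Under D True) :
    ContinuumYM4Torus D :=
  continuumYM4Torus_of_hybridNE7Under_any D hD hB trivial hNE

/-- Sanity: `Hβ := DagBinding.EndpointExistence D.C.toB12` is the tree's print-faithful headline :814 (same binders). [folklore] -/
example (D : FiniteEpsData F (Matrix.specialUnitaryGroup (Fin N) ℂ)) (hD : D.IsPrintedAveraged) (hB : B16.EndStatementBPrinted D.C)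
    (hEnd : DagBinding.EndpointExistence D.C.toB12)
    (hNE : T4ApexHybrid.HybridNE7Under D (DagBinding.EndpointExistence D.C.toB12)) : ContinuumYM4Torus D :=
  continuumYM4Torus_of_hybridNE7Under_any D hD hB hEnd hNE

/-- Sanity: `Hβ := BetaPertHyp D.βfun` is the tree's packaged headline :547 (same binders). [folklore] -/
example (D : FiniteEpsData F (Matrix.specialUnitaryGroup (Fin N) ℂ)) (hD : D.IsPrintedAveraged) (hB : B16.EndStatementBPrinted D.C)
    (hβ : BetaPertHyp D.βfun) (hNE : T4ApexHybrid.HybridNE7Under D (BetaPertHyp D.βfun)) : ContinuumYM4Torus D :=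
  continuumYM4Torus_of_hybridNE7Under_any D hD hB hβ hNE

/-- The spine slot is ANTI-MONOTONE in the β-antecedent: supplied under a weaker `H₂` (implied by `H₁`) it serves under `H₁`.  (Restates
`T4ApexHybrid.HybridNE7Under.of_imp` at the use site: weakening the β-binder STRENGTHENS the ask of G2.) [folklore] -/
theorem hybridNE7Under_anti {D : FiniteEpsData F (Matrix.specialUnitaryGroup (Fin N) ℂ)} {H₁ H₂ : Prop} (himp : H₁ → H₂)
    (h : T4ApexHybrid.HybridNE7Under D H₂) : T4ApexHybrid.HybridNE7Under D H₁ :=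
  T4ApexHybrid.HybridNE7Under.of_imp himp h

end Generic

/-! ## §2 Non-vacuity needs endpoint existence at ONE torus exponent (split S5 ∕ use site U3(b)) -/

section OneExponent

/-- **ENDPOINT EXISTENCE AT ONE TORUS EXPONENT `m`** — the `m`-th instance of `DagBinding.EndpointExistence C` ([Balaban1987RG1] Thm 2
p. 259, endpoint half: for all small `γ`, `g` and every `K` some bare coupling gives a run in `]0, γ]` ending at `g_K = g`, on the torus
of exponent `m`).  UNPRINTED as a theorem (proof announced p. 259, never published); a HYPOTHESIS SHAPE, never asserted.
`EndpointExistence C ↔ ∀ m, EndpointExistenceAt C m` (`endpointExistence_iff_forall_at`). [cite: Balaban1987RG1, Thm 2 p.259] -/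
def EndpointExistenceAt (C : B12.Construction) (m : ℕ) : Prop :=
  ∃ γ₂ : ℝ, 0 < γ₂ ∧ ∀ γ : ℝ, 0 < γ → γ ≤ γ₂ →
    ∃ gstar : ℝ, 0 < gstar ∧ ∀ g : ℝ, 0 < g → g ≤ gstar →
      ∀ K : ℕ, ∃ g0 : ℝ, (C ⟨K, m, g0⟩).flow.InInterval γ K ∧ (C ⟨K, m, g0⟩).flow.g K = g

/-- `EndpointExistence C` is literally `∀ m, EndpointExistenceAt C m`. [folklore] -/
theorem endpointExistence_iff_forall_at (C : B12.Construction) :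
    DagBinding.EndpointExistence C ↔ ∀ m, EndpointExistenceAt C m :=
  Iff.rfl

/-- The all-exponent statement gives each one-exponent instance. [folklore] -/
theorem endpointExistenceAt_of_endpointExistence {C : B12.Construction} (h : DagBinding.EndpointExistence C) (m : ℕ) :
    EndpointExistenceAt C m :=
  h m

variable {F : T4Family} {G : Type u} [GaugeGroup G] [MeasurableSpace G] [HaarData G]

/-- **TUNED SEQUENCES EXIST UNDER THE ONE-EXPONENT BINDER**: the datum's tuning predicate `D.Tuned γ g g₀` fixes the torus exponent to
`F.m` (T4Continuum.lean :866), so `EndpointExistenceAt D.C.toB12 F.m` already gives, for all small `γ`, `g`, SOME tuned bare-coupling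
sequence (the tree's `exists_tuned` :1204 asks the all-`m` statement and uses only `m = F.m`). [cite: Balaban1987RG1, Thm 2 p.259] -/
theorem exists_tuned_at (D : FiniteEpsData F G) (hex : EndpointExistenceAt D.C.toB12 F.m) :
    ∃ γ₀ : ℝ, 0 < γ₀ ∧ ∀ γ : ℝ, 0 < γ → γ ≤ γ₀ → ∃ g₁ : ℝ, 0 < g₁ ∧ ∀ g : ℝ, 0 < g → g ≤ g₁ →
      ∃ g₀ : ℕ → ℝ, D.Tuned γ g g₀ := by
  obtain ⟨γ₂, hγ₂, H⟩ := hex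
  refine ⟨γ₂, hγ₂, fun γ hγ hγle => ?_⟩
  obtain ⟨gstar, hgstar, Hg⟩ := H γ hγ hγle
  refine ⟨gstar, hgstar, fun g hg hgle => ?_⟩
  choose g₀ hg₀ using Hg g hg hgle
  exact ⟨g₀, fun K => hg₀ K⟩

/-- ∀-form ⇒ ∃-form under the ONE-EXPONENT binder (the tree's `ForSmallCouplings.toE` :329 with `exists_tuned_at` in place of
`exists_tuned`). [folklore] -/
theorem forSmallCouplings_toE_at {D : FiniteEpsData F G} {c : (ℕ → ℝ) → Prop} (hex : EndpointExistenceAt D.C.toB12 F.m)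
    (h : ForSmallCouplings D c) : ForSmallCouplingsE D c := by
  obtain ⟨γ₀, hγ₀, H⟩ := h
  obtain ⟨γ₂, hγ₂, H₂⟩ := exists_tuned_at D hex
  refine ⟨min γ₀ γ₂, lt_min hγ₀ hγ₂, fun γ hγ hγle => ?_⟩
  obtain ⟨g₁, hg₁, Hg⟩ := H γ hγ (hγle.trans (min_le_left _ _))
  obtain ⟨g₂, hg₂, Hg₂⟩ := H₂ γ hγ (hγle.trans (min_le_right _ _))
  refine ⟨min g₁ g₂, lt_min hg₁ hg₂, fun g hg hgle => ?_⟩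
  obtain ⟨g₀, ht⟩ := Hg₂ g hg (hgle.trans (min_le_right _ _))
  exact ⟨g₀, ht, Hg g hg (hgle.trans (min_le_left _ _)) g₀ ht⟩

/-- `ContinuumYM4Torus D` ⇒ its ∃-reading `ContinuumYM4TorusE D` under the one-exponent binder. [folklore] -/
theorem continuumYM4TorusE_of_endpointAt {D : FiniteEpsData F G} (hex : EndpointExistenceAt D.C.toB12 F.m)
    (h : ContinuumYM4Torus D) : ContinuumYM4TorusE D :=
  forSmallCouplings_toE_at hex h

end OneExponent

section OneExponentSU

variable {F : T4Family} {N : ℕ} [NeZero N]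

/-- **THE NON-VACUOUS HEADLINE FROM THE ONE-EXPONENT BINDER** (∀-form ∧ ∃-form): printed-averaged datum on `SU(N)`, (B), endpoint
existence AT `m = F.m` only, and the spine slot under that binder ⇒ `ContinuumYM4Torus D ∧ ContinuumYM4TorusE D`.  This is the exact
non-vacuity content of use site U3(b): nothing about other torus exponents is consumed. [cite: Balaban1987RG1, Thm 2 p.259] -/
theorem continuumYM4Torus_of_endpointExistenceAt_nonvacuous (D : FiniteEpsData F (Matrix.specialUnitaryGroup (Fin N) ℂ))
    (hD : D.IsPrintedAveraged) (hB : B16.EndStatementBPrinted D.C) (hEnd : EndpointExistenceAt D.C.toB12 F.m)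
    (hNE : T4ApexHybrid.HybridNE7Under D (EndpointExistenceAt D.C.toB12 F.m)) :
    ContinuumYM4Torus D ∧ ContinuumYM4TorusE D :=
  have h := continuumYM4Torus_of_hybridNE7Under_any D hD hB hEnd hNE
  ⟨h, continuumYM4TorusE_of_endpointAt hEnd h⟩

/-- The same statement under the skeleton's name (`HOME/g1/skeletons/SK0_BetaGenericHeadline.lean` b0db4a5639dcbb73,
`continuumYM4Torus_nonvacuous_of_at`; its two stubs are `exists_tuned_at` ∕ `continuumYM4TorusE_of_endpointAt` above). [folklore] -/
theorem continuumYM4Torus_nonvacuous_of_at (D : FiniteEpsData F (Matrix.specialUnitaryGroup (Fin N) ℂ))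
    (hD : D.IsPrintedAveraged) (hB : B16.EndStatementBPrinted D.C) (hex : EndpointExistenceAt D.C.toB12 F.m)
    (hNE : T4ApexHybrid.HybridNE7Under D (EndpointExistenceAt D.C.toB12 F.m)) :
    ContinuumYM4Torus D ∧ ContinuumYM4TorusE D :=
  continuumYM4Torus_of_endpointExistenceAt_nonvacuous D hD hB hex hNE

/-- A slot under `EndpointExistenceAt … F.m` (the WEAKER antecedent) serves under `EndpointExistence` (anti-monotonicity): the print-faithful
headline's spine binder is implied by the one-exponent one, not conversely. [folklore] -/
theorem hybridNE7Under_endpoint_of_at {D : FiniteEpsData F (Matrix.specialUnitaryGroup (Fin N) ℂ)}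
    (h : T4ApexHybrid.HybridNE7Under D (EndpointExistenceAt D.C.toB12 F.m)) :
    T4ApexHybrid.HybridNE7Under D (DagBinding.EndpointExistence D.C.toB12) :=
  T4ApexHybrid.HybridNE7Under.of_imp (fun hE => endpointExistenceAt_of_endpointExistence hE F.m) h

end OneExponentSU

end Summit.QuantumFields.BalabanUV.Gaps.BetaGenericHeadline
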